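import Literature.Geometry.DiscreteGeometry.ShellCensusReplayLPText
import HarnessLib

/-!
# Census certificates with contact-graph leaves: graph claims, the checker, soundness

Topic `Literature/Geometry/DiscreteGeometry`; replayer EXTENSION #4, for the one-shell link census
of crux `SquareWellLayerCake.GapTwelveToBarlow` (stmt-AtomisticToContinuum-15807, stub
`stub_linkCensus`: the contact graph of a gapped twelve-shell is the cuboctahedral, the
anticuboctahedral or the bicapped-pentagonal-prism graph). Built on `ShellCensusReplayLP*.lean`
(`LTree`, `LTree.check_sound`, `LCensus`, the text readers) and `ShellCensusReplayEscape*.lean`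
(`EClaim`, `DegOK`, `FacetLE`, `eclaim_of_relabel`, `sat_case`).

## Why a new layer

The conclusion of the replayers so far is metric (`Good`: `eta`-closeness to an anchor) or, without
anchors, plain infeasibility. A link census needs a COMBINATORIAL conclusion: the decided pairs
realise, up to relabelling, one of finitely many TARGET lists (typically the fully decided contact
graphs of the admissible patterns) — admissible shells deform too much for closeness to finitely
many anchors to be certifiable at useful `eta`. This file adds that conclusion on top of the
infeasibility certificates: `Spec.GraphGood targets t` (some target list, relabelled by a
permutation, is satisfied by `t`) and the claim `Spec.GClaim dmin dmax f targets S` (every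
admissible `t` in the degree window with the facet condition satisfying `S` is graph-good).

## Certificates (`GTree`, `GCensus`) and the checker

`GTree`: `case k l` (the admissibility alternative), `sub tr` (an `LTree` certificate that the
current list is INFEASIBLE, checked by `LTree.check` against the infeasible context `ictx`),
`dead π j` (the current list contains the relabelled infeasible context entry `ictx[j]`),
`same π j` (it contains the relabelled earlier graph claim `gctx[j]`; the relabelling must fix
the facet labels, `fixesB`), `good π j` (it contains the relabelled target `targets[j]`).
`GCensus.checkFrom` checks entries in order, the constraint lists of the earlier entries forming
`gctx`; `GCensus.check` also verifies `okB`, that target labels are in range (`targetsOK`) and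
that some entry has the wanted list. The infeasible context is established separately (chains of
`LCensus.checkFrom`, `LCensus.claims_append_of_checkFrom`), so that large geometric certificates
and the combinatorial census live in different files. Soundness: `GTree.check_sound`,
`GCensus.checkFrom_sound`, **`GCensus.check_sound`**; text decoder `GCensus.ofText` (grammar in
the section docstring). Everything is computable; toy censuses are checked in the kernel.

## References
* O. R. Musin, A. S. Tarasov, DCG 48 (2012), §4 (graph list + certified elimination). [cite: MusinTarasov2012, §4]
* R. E. Moore, *Interval Analysis* (1966), §4.4. [cite: Moore1966, §4.4]
-/

namespace Literature.Geometry.DiscreteGeometry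

open Literature.Analysis.ValidatedNumerics Finset

/-- Euclidean `3`-space. -/
local notation "E3" => EuclideanSpace ℝ (Fin 3)

namespace ShellCensus

/-! ### Graph claims -/

/-- Composition of relabellings given as lists: `(pcomp π ρ)[k] = π[ρ[k]]`. [folklore] -/
def pcomp (π ρ : List ℕ) : List ℕ := ρ.map (papp π)

/-- All labels of the target lists are `< n` (so relabellings act on them faithfully). [folklore] -/
def targetsOK (n : ℕ) (targets : Array (List Constraint)) : Bool :=
  targets.toList.all fun T => T.all fun c => decide (c.1 < n) && decide (c.2.1 < n)

namespace Spec

variable (P : Spec)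

/-- **Graph-good tuples**: some target list, relabelled by a permutation, is satisfied. [folklore] -/
def GraphGood (targets : Array (List Constraint)) (t : Fin P.n → E3) : Prop :=
  ∃ (j : ℕ) (hj : j < targets.size) (π : List ℕ), permOK P.n π = true ∧ P.Sat (relabel π targets[j]) t

/-- **The graph claim of a constraint list**: every admissible tuple in the degree window, with
the facet condition, satisfying the constraints, is graph-good. [folklore] -/
def GClaim (dmin dmax : ℕ) (f : Option (ℕ × ℕ × ℕ)) (targets : Array (List Constraint))
    (S : List Constraint) : Prop :=
  ∀ t : Fin P.n → E3, P.Admissible t → P.DegOK dmin dmax t → P.FacetLE f t → P.Sat S t →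
    P.GraphGood targets t

end Spec

/-! ### Relabellings -/

section Relabel

variable {n : ℕ} {π ρ : List ℕ}

/-- Unpacking `permOK`. [folklore] -/
theorem permOK_iff : permOK n π = true ↔ π.length = n ∧ (∀ x ∈ π, x < n) ∧ π.Nodup := by
  simp [permOK, Bool.and_eq_true, List.all_eq_true, and_assoc]

/-- `papp` of an accepted list is injective on `{0, …, n−1}`. [folklore] -/
theorem papp_injOn (h : permOK n π = true) {a b : ℕ} (ha : a < n) (hb : b < n)
    (hab : papp π a = papp π b) : a = b := by
  obtain ⟨hlen, -, hnd⟩ := permOK_iff.1 h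
  unfold papp at hab
  rw [List.getD_eq_getElem _ _ (hlen ▸ ha), List.getD_eq_getElem _ _ (hlen ▸ hb)] at hab
  exact (List.Nodup.getElem_inj_iff hnd).1 hab

/-- `pcomp` evaluates as composition on `{0, …, n−1}`. [folklore] -/
theorem papp_pcomp (hρ : permOK n ρ = true) {k : ℕ} (hk : k < n) :
    papp (pcomp π ρ) k = papp π (papp ρ k) := by
  obtain ⟨hlen, -, -⟩ := permOK_iff.1 hρ
  have hk' : k < ρ.length := hlen ▸ hk
  have h1 : papp ρ k = ρ[k] := by unfold papp; rw [List.getD_eq_getElem _ _ hk']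
  have h2 : papp (pcomp π ρ) k = (ρ.map (papp π))[k]'(by simpa using hk') := by
    simp only [pcomp, papp]
    rw [List.getD_eq_getElem _ _ (by simpa using hk')]
  rw [h2, h1, List.getElem_map]

/-- The composition of accepted lists is accepted. [folklore] -/
theorem permOK_pcomp (hπ : permOK n π = true) (hρ : permOK n ρ = true) : permOK n (pcomp π ρ) = true := by
  obtain ⟨hlen, hall, hnd⟩ := permOK_iff.1 hρ
  refine permOK_iff.2 ⟨by simp [pcomp, hlen], ?_, ?_⟩
  · intro x hx
    obtain ⟨y, hy, rfl⟩ := List.mem_map.1 hx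
    exact papp_lt hπ (hall y hy)
  · refine List.Nodup.map_on ?_ hnd
    intro x hx y hy hxy
    exact papp_injOn hπ (hall x hx) (hall y hy) hxy

end Relabel

namespace Spec

variable {P : Spec}

/-- `Sat` is antitone in the constraint list. [folklore] -/
theorem sat_mono {S S' : List Constraint} {t : Fin P.n → E3} (hsub : ∀ c ∈ S, c ∈ S')
    (h : P.Sat S' t) : P.Sat S t := fun c hc => h c (hsub c hc)

/-- Satisfaction of a relabelled in-range list by `t ∘ permOf` is satisfaction of the list
relabelled by the composition. [folklore] -/
theorem sat_relabel_pcomp {π ρ : List ℕ} (hπ : permOK P.n π = true) (hρ : permOK P.n ρ = true)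
    {T : List Constraint} (hT : ∀ c ∈ T, c.1 < P.n ∧ c.2.1 < P.n) {t : Fin P.n → E3}
    (h : P.Sat (relabel ρ T) (t ∘ permOf hπ)) : P.Sat (relabel (pcomp π ρ) T) t := by
  intro c hc hk hl
  obtain ⟨c₀, hc₀, rfl⟩ := List.mem_map.1 hc
  obtain ⟨ha, hb⟩ := hT c₀ hc₀
  have hmem : (papp ρ c₀.1, papp ρ c₀.2.1, c₀.2.2) ∈ relabel ρ T := List.mem_map.2 ⟨c₀, hc₀, rfl⟩
  have h' := h _ hmem (papp_lt hρ ha) (papp_lt hρ hb)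
  have e1 : (⟨papp (pcomp π ρ) c₀.1, hk⟩ : Fin P.n) = permOf hπ ⟨papp ρ c₀.1, papp_lt hρ ha⟩ :=
    Fin.ext (by rw [permOf_apply_val]; exact papp_pcomp hρ ha)
  have e2 : (⟨papp (pcomp π ρ) c₀.2.1, hl⟩ : Fin P.n) = permOf hπ ⟨papp ρ c₀.2.1, papp_lt hρ hb⟩ :=
    Fin.ext (by rw [permOf_apply_val]; exact papp_pcomp hρ hb)
  simp only [Function.comp_apply] at h'
  rw [e1, e2]
  exact h'

/-- Graph-goodness transports back along a relabelling (targets in range). [folklore] -/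
theorem graphGood_of_comp_permOf {targets : Array (List Constraint)} (htg : targetsOK P.n targets = true)
    {π : List ℕ} (hπ : permOK P.n π = true) {t : Fin P.n → E3}
    (h : P.GraphGood targets (t ∘ permOf hπ)) : P.GraphGood targets t := by
  obtain ⟨j, hj, ρ, hρ, hsat⟩ := h
  have hT : ∀ c ∈ targets[j], c.1 < P.n ∧ c.2.1 < P.n := by
    simp only [targetsOK, List.all_eq_true, Bool.and_eq_true, decide_eq_true_eq] at htg
    exact htg _ (Array.getElem_mem_toList hj)
  exact ⟨j, hj, pcomp π ρ, permOK_pcomp hπ hρ, sat_relabel_pcomp hπ hρ hT hsat⟩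

variable {dmin dmax : ℕ} {f : Option (ℕ × ℕ × ℕ)} {targets : Array (List Constraint)}

/-- **Rule `case`** for graph claims. [folklore] -/
theorem gclaim_case {S : List Constraint} {k l : ℕ} (hk : k < P.n) (hl : l < P.n) (hkl : k ≠ l)
    (hb : P.GClaim dmin dmax f targets ((k, l, true) :: S))
    (hf : P.GClaim dmin dmax f targets ((k, l, false) :: S)) : P.GClaim dmin dmax f targets S := by
  intro t ht hdeg hfa hS
  rcases sat_case hk hl hkl ht hS with h | h
  · exact hb t ht hdeg hfa h
  · exact hf t ht hdeg hfa h

/-- **Rules `sub` / `dead`**: an infeasible list has every graph claim. [folklore] -/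
theorem gclaim_of_eclaim (hA : P.anchors = []) {S : List Constraint}
    (h : P.EClaim (P.emptyPatterns hA) dmin dmax f S) : P.GClaim dmin dmax f targets S :=
  fun t ht hdeg hfa hS => (EClaim.elim_nil hA h t ht hdeg hfa hS).elim

/-- **Rule `same`**: an established graph claim, relabelled by a permutation fixing the facet
labels, implies every graph claim with more constraints. [folklore] -/
theorem gclaim_of_relabel (htg : targetsOK P.n targets = true) {S₀ S : List Constraint} {π : List ℕ}
    (hπ : permOK P.n π = true) (hfix : fixesB f π = true) (hsub : ∀ c ∈ relabel π S₀, c ∈ S)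
    (h0 : P.GClaim dmin dmax f targets S₀) : P.GClaim dmin dmax f targets S := by
  intro t ht hdeg hfa hS
  refine graphGood_of_comp_permOf htg hπ (h0 _ (ht.comp_perm _) (degOK_comp_perm hdeg _)
    (facetLE_comp_permOf hπ hfix hfa) ?_)
  intro c hc hk hl
  have hmem : (papp π c.1, papp π c.2.1, c.2.2) ∈ relabel π S₀ := List.mem_map.2 ⟨c, hc, rfl⟩
  have h := hS _ (hsub _ hmem) (papp_lt hπ hk) (papp_lt hπ hl)
  simpa [Function.comp, permOf] using h

/-- **Rule `good`**: a list containing a relabelled target is graph-good. [folklore] -/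
theorem gclaim_of_target {S : List Constraint} {π : List ℕ} {j : ℕ} (hj : j < targets.size)
    (hπ : permOK P.n π = true) (hsub : ∀ c ∈ relabel π targets[j], c ∈ S) :
    P.GClaim dmin dmax f targets S :=
  fun _ _ _ _ hS => ⟨j, hj, π, hπ, sat_mono hsub hS⟩

end Spec

/-! ### Certificates and the checker -/

/-- **Census certificate trees with contact-graph leaves.** [folklore] -/
inductive GTree : Type
  /-- case split on the pair `(k, l)` -/
  | case (k l : ℕ) (bond far : GTree)
  /-- the current list is infeasible: an `LTree` certificate -/
  | sub (tr : LTree)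
  /-- the current list contains the relabelled infeasible context entry `j` -/
  | dead (perm : List ℕ) (j : ℕ)
  /-- the current list contains the relabelled earlier graph claim `j` -/
  | same (perm : List ℕ) (j : ℕ)
  /-- the current list contains the relabelled target `j` -/
  | good (perm : List ℕ) (j : ℕ)
  deriving Inhabited

/-- Containment of a relabelled list, as checked by the `ref`-type rules. [folklore] -/
def subRelabel (π : List ℕ) (S₀ S : List Constraint) : Bool := (relabel π S₀).all fun c => decide (c ∈ S)

/-- **The checker** (structural recursion; kernel-evaluable): `ictx` = infeasible lists,
`gctx` = established graph claims, `targets` = target lists. [folklore] -/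
def GTree.check (P : Spec) (dmin dmax : ℕ) (f : Option (ℕ × ℕ × ℕ))
    (ictx gctx targets : Array (List Constraint)) : List Constraint → GTree → Bool
  | S, .case k l tb tf => decide (k < P.n) && decide (l < P.n) && !(k == l) &&
      GTree.check P dmin dmax f ictx gctx targets ((k, l, true) :: S) tb &&
        GTree.check P dmin dmax f ictx gctx targets ((k, l, false) :: S) tf
  | S, .sub tr => tr.check P dmin dmax f ictx S none
  | S, .dead π j =>
      match ictx[j]? with
      | none => false
      | some S₀ => permOK P.n π && fixesB f π && subRelabel π S₀ S
  | S, .same π j =>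
      match gctx[j]? with
      | none => false
      | some S₀ => permOK P.n π && fixesB f π && subRelabel π S₀ S
  | S, .good π j =>
      match targets[j]? with
      | none => false
      | some T => permOK P.n π && subRelabel π T S

/-- A **graph census**: constraint lists with their trees, in dependency order. [folklore] -/
abbrev GCensus : Type := List (List Constraint × GTree)

/-- Check the entries in order, each against the graph claims of the earlier ones. [folklore] -/
def GCensus.checkFrom (P : Spec) (dmin dmax : ℕ) (f : Option (ℕ × ℕ × ℕ))
    (ictx targets : Array (List Constraint)) : Array (List Constraint) → GCensus → Bool
  | _, [] => true
  | gctx, (S, tr) :: rest =>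
      tr.check P dmin dmax f ictx gctx targets S && GCensus.checkFrom P dmin dmax f ictx targets (gctx.push S) rest

/-- **The graph-census checker**: sound data, targets in range, every entry checks, and some
entry has the wanted list `S`. [folklore] -/
def GCensus.check (P : Spec) (dmin dmax : ℕ) (f : Option (ℕ × ℕ × ℕ))
    (ictx targets : Array (List Constraint)) (S : List Constraint) (C : GCensus) : Bool :=
  P.okB && targetsOK P.n targets && GCensus.checkFrom P dmin dmax f ictx targets #[] C &&
    C.any fun e => decide (e.1 = S)

/-! ### Soundness -/

/-- Unpacking `subRelabel`. [folklore] -/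
theorem subRelabel_iff {π : List ℕ} {S₀ S : List Constraint} :
    subRelabel π S₀ S = true ↔ ∀ c ∈ relabel π S₀, c ∈ S := by
  simp [subRelabel, List.all_eq_true]

/-- **Soundness of the tree checker**: with the infeasible context and the earlier graph claims
established, an accepted tree establishes the graph claim of its list. [folklore] -/
theorem GTree.check_sound {P : Spec} (hA : P.anchors = []) {dmin dmax : ℕ} {f : Option (ℕ × ℕ × ℕ)}
    (hP : P.okB = true) (ictx gctx targets : Array (List Constraint)) (htg : targetsOK P.n targets = true)
    (hictx : ∀ (j : ℕ) (hj : j < ictx.size), P.EClaim (P.emptyPatterns hA) dmin dmax f ictx[j])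
    (hgctx : ∀ (j : ℕ) (hj : j < gctx.size), P.GClaim dmin dmax f targets gctx[j]) :
    ∀ (tr : GTree) (S : List Constraint),
      tr.check P dmin dmax f ictx gctx targets S = true → P.GClaim dmin dmax f targets S
  | .case k l tb tf, S, h => by
    simp only [GTree.check, Bool.and_eq_true, decide_eq_true_eq, Bool.not_eq_true',
      beq_eq_false_iff_ne, ne_eq] at h
    obtain ⟨⟨⟨⟨hk, hl⟩, hkl⟩, hb⟩, hf⟩ := h
    exact Spec.gclaim_case hk hl hkl (GTree.check_sound hA hP ictx gctx targets htg hictx hgctx tb _ hb)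
      (GTree.check_sound hA hP ictx gctx targets htg hictx hgctx tf _ hf)
  | .sub tr, S, h => Spec.gclaim_of_eclaim hA (LTree.check_sound (P.emptyPatterns hA) hP ictx hictx tr S none h)
  | .dead π j, S, h => by
    simp only [GTree.check] at h
    split at h
    · exact absurd h Bool.false_ne_true
    · rename_i S₀ hS₀
      obtain ⟨hj, rfl⟩ := Array.getElem?_eq_some_iff.1 hS₀
      simp only [Bool.and_eq_true] at h
      exact Spec.gclaim_of_eclaim hA
        (Spec.eclaim_of_relabel h.1.1 h.1.2 (subRelabel_iff.1 h.2) (hictx j hj))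
  | .same π j, S, h => by
    simp only [GTree.check] at h
    split at h
    · exact absurd h Bool.false_ne_true
    · rename_i S₀ hS₀
      obtain ⟨hj, rfl⟩ := Array.getElem?_eq_some_iff.1 hS₀
      simp only [Bool.and_eq_true] at h
      exact Spec.gclaim_of_relabel htg h.1.1 h.1.2 (subRelabel_iff.1 h.2) (hgctx j hj)
  | .good π j, S, h => by
    simp only [GTree.check] at h
    split at h
    · exact absurd h Bool.false_ne_true
    · rename_i T hT
      obtain ⟨hj, rfl⟩ := Array.getElem?_eq_some_iff.1 hT
      simp only [Bool.and_eq_true] at h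
      exact Spec.gclaim_of_target hj h.1 (subRelabel_iff.1 h.2)

/-- **Soundness of `GCensus.checkFrom`** (also the composition rule across files). [folklore] -/
theorem GCensus.checkFrom_sound {P : Spec} (hA : P.anchors = []) {dmin dmax : ℕ} {f : Option (ℕ × ℕ × ℕ)}
    (hP : P.okB = true) (ictx targets : Array (List Constraint)) (htg : targetsOK P.n targets = true)
    (hictx : ∀ (j : ℕ) (hj : j < ictx.size), P.EClaim (P.emptyPatterns hA) dmin dmax f ictx[j]) :
    ∀ (C : GCensus) (gctx : Array (List Constraint)),
      (∀ (j : ℕ) (hj : j < gctx.size), P.GClaim dmin dmax f targets gctx[j]) →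
      GCensus.checkFrom P dmin dmax f ictx targets gctx C = true → ∀ e ∈ C, P.GClaim dmin dmax f targets e.1
  | [], _, _, _ => by simp
  | (S, tr) :: rest, gctx, hgctx, h => by
    simp only [GCensus.checkFrom, Bool.and_eq_true] at h
    obtain ⟨h1, h2⟩ := h
    have hS : P.GClaim dmin dmax f targets S := GTree.check_sound hA hP ictx gctx targets htg hictx hgctx tr S h1
    have hgctx' : ∀ (j : ℕ) (hj : j < (gctx.push S).size), P.GClaim dmin dmax f targets (gctx.push S)[j] := by
      intro j hj
      rw [Array.getElem_push]
      split
      · exact hgctx j _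
      · exact hS
    intro e he
    rcases List.mem_cons.1 he with rfl | he
    · exact hS
    · exact GCensus.checkFrom_sound hA hP ictx targets htg hictx rest (gctx.push S) hgctx' h2 e he

/-- **Soundness of the graph-census checker**: with the infeasible context established, an
accepted graph census establishes the graph claim of the wanted list. [folklore] -/
theorem GCensus.check_sound {P : Spec} (hA : P.anchors = []) {dmin dmax : ℕ} {f : Option (ℕ × ℕ × ℕ)}
    {ictx targets : Array (List Constraint)} {S : List Constraint} (C : GCensus)
    (hictx : ∀ (j : ℕ) (hj : j < ictx.size), P.EClaim (P.emptyPatterns hA) dmin dmax f ictx[j])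
    (h : GCensus.check P dmin dmax f ictx targets S C = true) : P.GClaim dmin dmax f targets S := by
  simp only [GCensus.check, Bool.and_eq_true, List.any_eq_true, decide_eq_true_eq] at h
  obtain ⟨⟨⟨hP, htg⟩, hC⟩, e, he, rfl⟩ := h
  exact GCensus.checkFrom_sound hA hP ictx targets htg hictx C #[] (fun j hj => absurd hj (by simp)) hC e he

/-! ### A toy graph census, checked in the kernel -/

/-- For `toyLSpec` in the degree window `[0, 0]`: the list `[]` realises the (silly) target
`[(0, 1, true)]` or is infeasible — bond: `good`; far: `dead` (context: `[(0,1,false)]` is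
infeasible, `toyLCensus`). A second entry uses `same`. [folklore] -/
def toyGCensus : GCensus :=
  [([], .case 0 1 (.good [0, 1, 2] 0) (.dead [0, 1, 2] 0)),
   ([(2, 1, true)], .case 0 2 (.sub (.capped 0)) (.same [1, 0, 2] 0))]

/-- The toy graph census is accepted (kernel evaluation). [folklore] -/
theorem toyGCensus_check :
    GCensus.check toyLSpec 0 0 none #[[(0, 1, false)]] #[[(0, 1, true)]] [(2, 1, true)] toyGCensus = true := by
  decide +kernel

/-- End-to-end on the toys: the infeasible context from `toyLCensus_check`, then the graph claim. -/
example : toyLSpec.GClaim 0 0 none #[[(0, 1, true)]] [(2, 1, true)] :=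
  GCensus.check_sound (ictx := #[[(0, 1, false)]]) rfl toyGCensus
    (by
      intro j hj
      have hj0 : j = 0 := by simp at hj; omega
      subst hj0
      exact LCensus.check_sound _ toyLCensus toyLCensus_check)
    toyGCensus_check

end ShellCensus

end Literature.Geometry.DiscreteGeometry
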